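import Summits.RiemannHypothesis.RiemannHypothesis.Theses.WeilComb
import Summits.RiemannHypothesis.RiemannHypothesis.Theorems.WeilCombCombShapeAdmissible
import Literature.NumberTheory.LFunctions.WeilExplicit
import Literature.NumberTheory.LFunctions.WeilMellinBounds

/-!
# The pole coefficient of the fixed-shape comb is the square of a positive real
(crux `WeilComb.CombShapePositivity`, item stmt-RiemannHypothesis-11229, line `Sketch`; sub-goal
`weilMellin_dilBump_zero_one` of the Theorem-B stub `stub_window`)

Notation: `φ₀(u) = expNegInvGlue (1 - u²)` (the route's fixed bump), `φ_ε(t) = ε⁻¹ φ₀(t/ε)`,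
`ĥ = weilMellin h`, `ĥ(s) = ∫ h(t) e^{(s - 1/2) t} dt`.

**Statement.** For `ε > 0`,
`φ̂_ε(0) = φ̂_ε(1) = ∫ φ₀(u) cosh(ε u / 2) du`, and this real number is `> 0`. Consequently the
coefficient `φ̂_ε(0) conj φ̂_ε(1)` of the polar term `2 Re(φ̂_ε(0) conj φ̂_ε(1) · A₋ conj A₊)`
of the comb autocorrelation (`weilPolarTerm_comb_re`) is the square of a positive real number.

**Proof.** Substituting `t = ε u` (`MeasureTheory.Measure.integral_comp_div`),
`φ̂_ε(s) = ∫ φ₀(u) e^{(s - 1/2) ε u} du`. At `s = 0` and `s = 1` the kernel is the real exponential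
`e^{∓ε u/2} = cosh(ε u/2) ∓ sinh(ε u/2)`, and `∫ φ₀(u) sinh(ε u/2) du = 0` because `φ₀` is even,
`sinh` is odd and Lebesgue measure is even (`MeasureTheory.integral_neg_eq_self`). Positivity: the
integrand `φ₀(u) cosh(ε u/2)` is continuous, supported in `[-1, 1]`, nonnegative, and positive at
`u = 0` (`MeasureTheory.integral_pos_of_integrable_nonneg_nonzero`).
-/

noncomputable section

-- the sub-problem path RiemannHypothesis/RiemannHypothesis duplicates a namespace (D-0017)
set_option linter.dupNamespace false

open scoped BigOperators ComplexConjugate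
open Complex MeasureTheory Set

namespace Summit.RiemannHypothesis.RiemannHypothesis.Theorems.WeilCombBohrFejer

open Literature.NumberTheory.LFunctions

/-! ### The real bump `φ₀`: continuity, support, integrability against continuous weights -/

/-- The real bump `u ↦ expNegInvGlue (1 - u²)` is continuous. [folklore] -/
private theorem continuous_shapeBump_real :
    Continuous fun u : ℝ => expNegInvGlue (1 - u ^ 2) :=
  (expNegInvGlue.contDiff (n := 0)).continuous.comp (continuous_const.sub (continuous_id.pow 2))

/-- The support of the real bump lies in `[-1, 1]` (off it `1 - u² ≤ 0`). [folklore] -/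
private theorem support_shapeBump_real_subset :
    Function.support (fun u : ℝ => expNegInvGlue (1 - u ^ 2)) ⊆ Icc (-1) 1 := by
  intro u hu
  refine weilComb_shapeBump_support_subset ?_
  rw [Function.mem_support] at hu ⊢
  exact Complex.ofReal_ne_zero.2 hu

/-- The real bump times any continuous weight is integrable (continuous, compactly supported in
`[-1, 1]`). [folklore] -/
private theorem integrable_shapeBump_real_mul {w : ℝ → ℝ} (hw : Continuous w) :
    Integrable fun u : ℝ => expNegInvGlue (1 - u ^ 2) * w u := by
  refine (continuous_shapeBump_real.mul hw).integrable_of_hasCompactSupport ?_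
  refine HasCompactSupport.of_support_subset_isCompact (isCompact_Icc (a := (-1 : ℝ)) (b := 1)) ?_
  intro u hu
  exact support_shapeBump_real_subset (left_ne_zero_of_mul hu)

/-! ### Even/odd bookkeeping: the two exponential moments are the `cosh`-moment -/

/-- Oddness: `∫ φ₀(u) sinh(ε u / 2) du = 0` (`φ₀` even, `sinh` odd, Lebesgue measure even).
[folklore] -/
private theorem integral_shapeBump_real_mul_sinh (ε : ℝ) :
    ∫ u : ℝ, expNegInvGlue (1 - u ^ 2) * Real.sinh (ε * u / 2) = 0 := by
  have h := integral_neg_eq_self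
    (fun u : ℝ => expNegInvGlue (1 - u ^ 2) * Real.sinh (ε * u / 2)) volume
  simp only [neg_sq, mul_neg, neg_div, Real.sinh_neg, integral_neg] at h
  linarith

/-- `∫ φ₀(u) e^{ε u/2} du = ∫ φ₀(u) cosh(ε u/2) du` (`exp = cosh + sinh` and oddness). [folklore] -/
private theorem integral_shapeBump_real_mul_exp (ε : ℝ) :
    ∫ u : ℝ, expNegInvGlue (1 - u ^ 2) * Real.exp (ε * u / 2) =
      ∫ u : ℝ, expNegInvGlue (1 - u ^ 2) * Real.cosh (ε * u / 2) := by
  have hc : Integrable fun u : ℝ => expNegInvGlue (1 - u ^ 2) * Real.cosh (ε * u / 2) :=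
    integrable_shapeBump_real_mul (by fun_prop)
  have hs : Integrable fun u : ℝ => expNegInvGlue (1 - u ^ 2) * Real.sinh (ε * u / 2) :=
    integrable_shapeBump_real_mul (by fun_prop)
  have e : (fun u : ℝ => expNegInvGlue (1 - u ^ 2) * Real.exp (ε * u / 2)) = fun u : ℝ =>
      expNegInvGlue (1 - u ^ 2) * Real.cosh (ε * u / 2) +
        expNegInvGlue (1 - u ^ 2) * Real.sinh (ε * u / 2) := by
    funext u
    rw [← Real.cosh_add_sinh, mul_add]
  rw [e, integral_add hc hs, integral_shapeBump_real_mul_sinh, add_zero]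

/-- `∫ φ₀(u) e^{-ε u/2} du = ∫ φ₀(u) cosh(ε u/2) du` (`exp(-x) = cosh x - sinh x` and oddness).
[folklore] -/
private theorem integral_shapeBump_real_mul_exp_neg (ε : ℝ) :
    ∫ u : ℝ, expNegInvGlue (1 - u ^ 2) * Real.exp (-(ε * u / 2)) =
      ∫ u : ℝ, expNegInvGlue (1 - u ^ 2) * Real.cosh (ε * u / 2) := by
  have hc : Integrable fun u : ℝ => expNegInvGlue (1 - u ^ 2) * Real.cosh (ε * u / 2) :=
    integrable_shapeBump_real_mul (by fun_prop)
  have hs : Integrable fun u : ℝ => expNegInvGlue (1 - u ^ 2) * Real.sinh (ε * u / 2) :=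
    integrable_shapeBump_real_mul (by fun_prop)
  have e : (fun u : ℝ => expNegInvGlue (1 - u ^ 2) * Real.exp (-(ε * u / 2))) = fun u : ℝ =>
      expNegInvGlue (1 - u ^ 2) * Real.cosh (ε * u / 2) -
        expNegInvGlue (1 - u ^ 2) * Real.sinh (ε * u / 2) := by
    funext u
    rw [← Real.cosh_sub_sinh, mul_sub]
  rw [e, integral_sub hc hs, integral_shapeBump_real_mul_sinh, sub_zero]

/-! ### The transform of the dilated bump -/

/-- Dilation substitution `t = ε u` (`ε > 0`): `φ̂_ε(s) = ∫ φ₀(u) e^{(s - 1/2) ε u} du`, the factor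
`ε⁻¹ · |ε|` cancelling. [folklore] -/
private theorem weilMellin_dilShapeBump (ε : ℝ) (hε : 0 < ε) (s : ℂ) :
    weilMellin (fun t : ℝ => (ε : ℂ)⁻¹ * ((expNegInvGlue (1 - (t / ε) ^ 2) : ℝ) : ℂ)) s =
      ∫ u : ℝ, ((expNegInvGlue (1 - u ^ 2) : ℝ) : ℂ) * cexp ((s - 1 / 2) * ((ε * u : ℝ) : ℂ)) := by
  -- adapted from `SelfMajorantComplete.weilMellin_dilate` / `psi_zero_prime` (dilation through
  -- `MeasureTheory.Measure.integral_comp_div`)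
  unfold weilMellin
  have hεC : (ε : ℂ) ≠ 0 := Complex.ofReal_ne_zero.2 hε.ne'
  have h1 : (fun t : ℝ => (ε : ℂ)⁻¹ * ((expNegInvGlue (1 - (t / ε) ^ 2) : ℝ) : ℂ) *
        cexp ((s - 1 / 2) * (t : ℂ))) =
      fun t : ℝ => (ε : ℂ)⁻¹ * ((fun u : ℝ => ((expNegInvGlue (1 - u ^ 2) : ℝ) : ℂ) *
        cexp ((s - 1 / 2) * ((ε * u : ℝ) : ℂ))) (t / ε)) := by
    funext t
    simp only [mul_div_cancel₀ t hε.ne', mul_assoc]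
  rw [h1, integral_const_mul, Measure.integral_comp_div
      (fun u : ℝ => ((expNegInvGlue (1 - u ^ 2) : ℝ) : ℂ) *
        cexp ((s - 1 / 2) * ((ε * u : ℝ) : ℂ))) ε,
    abs_of_pos hε, Complex.real_smul, ← mul_assoc, inv_mul_cancel₀ hεC, one_mul]

/-- `φ̂_ε(0) = ∫ φ₀(u) cosh(ε u/2) du` (as a real number coerced to `ℂ`). [folklore] -/
private theorem weilMellin_dilShapeBump_zero (ε : ℝ) (hε : 0 < ε) :
    weilMellin (fun t : ℝ => (ε : ℂ)⁻¹ * ((expNegInvGlue (1 - (t / ε) ^ 2) : ℝ) : ℂ)) 0 =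
      ((∫ u : ℝ, expNegInvGlue (1 - u ^ 2) * Real.cosh (ε * u / 2) : ℝ) : ℂ) := by
  rw [weilMellin_dilShapeBump ε hε 0, ← integral_shapeBump_real_mul_exp_neg ε,
    ← integral_complex_ofReal]
  congr 1
  funext u
  have e : (0 - 1 / 2) * ((ε * u : ℝ) : ℂ) = ((-(ε * u / 2) : ℝ) : ℂ) := by
    push_cast
    ring
  rw [e, ← Complex.ofReal_exp, ← Complex.ofReal_mul]

/-- `φ̂_ε(1) = ∫ φ₀(u) cosh(ε u/2) du` (as a real number coerced to `ℂ`). [folklore] -/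
private theorem weilMellin_dilShapeBump_one (ε : ℝ) (hε : 0 < ε) :
    weilMellin (fun t : ℝ => (ε : ℂ)⁻¹ * ((expNegInvGlue (1 - (t / ε) ^ 2) : ℝ) : ℂ)) 1 =
      ((∫ u : ℝ, expNegInvGlue (1 - u ^ 2) * Real.cosh (ε * u / 2) : ℝ) : ℂ) := by
  rw [weilMellin_dilShapeBump ε hε 1, ← integral_shapeBump_real_mul_exp ε,
    ← integral_complex_ofReal]
  congr 1
  funext u
  have e : (1 - 1 / 2) * ((ε * u : ℝ) : ℂ) = ((ε * u / 2 : ℝ) : ℂ) := by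
    push_cast
    ring
  rw [e, ← Complex.ofReal_exp, ← Complex.ofReal_mul]

/-- The `cosh`-moment `∫ φ₀(u) cosh(ε u/2) du` is positive: the integrand is continuous, compactly
supported, nonnegative and positive at `u = 0`. [folklore] -/
private theorem integral_shapeBump_real_mul_cosh_pos (ε : ℝ) :
    0 < ∫ u : ℝ, expNegInvGlue (1 - u ^ 2) * Real.cosh (ε * u / 2) := by
  have hw : Continuous fun u : ℝ => Real.cosh (ε * u / 2) := by fun_prop
  refine integral_pos_of_integrable_nonneg_nonzero (x := 0) (continuous_shapeBump_real.mul hw)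
    (integrable_shapeBump_real_mul hw)
    (fun u => mul_nonneg (expNegInvGlue.nonneg _) (Real.cosh_pos _).le) ?_
  have h0 : 0 < expNegInvGlue (1 - (0 : ℝ) ^ 2) := expNegInvGlue.pos_of_pos (by norm_num)
  exact (mul_pos h0 (Real.cosh_pos _)).ne'

/-! ### The sub-goal -/

/-- **Pole coefficient of the fixed-shape comb** (sub-goal (e) of `stub_window`, line `Sketch` of
crux `WeilComb.CombShapePositivity`): for `ε > 0` and `φ_ε(t) = ε⁻¹ expNegInvGlue (1 - (t/ε)²)`,
`φ̂_ε(0) = φ̂_ε(1) = ∫ expNegInvGlue (1 - u²) cosh(ε u/2) du > 0`. Hence the pole coefficient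
`φ̂_ε(0) conj φ̂_ε(1)` in `weilPolarTerm_comb_re` is the square of a positive real. [folklore] -/
theorem weilMellin_dilBump_zero_one : ∀ ε : ℝ, 0 < ε →
    weilMellin (fun t : ℝ => (ε : ℂ)⁻¹ * ((expNegInvGlue (1 - (t / ε) ^ 2) : ℝ) : ℂ)) 0 =
        ((∫ u : ℝ, expNegInvGlue (1 - u ^ 2) * Real.cosh (ε * u / 2) : ℝ) : ℂ) ∧
      weilMellin (fun t : ℝ => (ε : ℂ)⁻¹ * ((expNegInvGlue (1 - (t / ε) ^ 2) : ℝ) : ℂ)) 1 =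
        ((∫ u : ℝ, expNegInvGlue (1 - u ^ 2) * Real.cosh (ε * u / 2) : ℝ) : ℂ) ∧
      0 < ∫ u : ℝ, expNegInvGlue (1 - u ^ 2) * Real.cosh (ε * u / 2) := by
  intro ε hε
  exact ⟨weilMellin_dilShapeBump_zero ε hε, weilMellin_dilShapeBump_one ε hε,
    integral_shapeBump_real_mul_cosh_pos ε⟩

end Summit.RiemannHypothesis.RiemannHypothesis.Theorems.WeilCombBohrFejer

end
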